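import Summits.KontsevichZagierPeriods.KontsevichZagierPeriods.Theorems.RootDecompRationalCubeDichotomyNashMultiGenP04

/-! # `RootDecompRationalCubeDichotomyNashMultiGenP05` — part 5/16 of the mechanical ≤385-line split of `NashEtaleMultiGen.lean`
(split by the decomp-kz census seat for landing; mathematics unchanged; part 5 continues part 4). -/

open Set MvPolynomial Filter Topology
open Literature.NumberTheory.Transcendental (IsSemialgebraicFunOn)
open Literature.ModelTheory.ExponentialFields (IsSemialgebraic isSemialgebraic_setOf_eval_pos
  isSemialgebraic_setOf_eval_ne_zero)

namespace Summit.KontsevichZagierPeriods.RootDecompRationalCubeDichotomy.Rung29430.MultiGen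
open Summit.KontsevichZagierPeriods.KontsevichZagierPeriods.Theses.RootDecompRationalCubeDichotomy
  (NashEtaleCover NashEtaleLocal PiRationalisation)
open Summit.KontsevichZagierPeriods.RootDecompRationalCubeDichotomy.Rung29430.NashEtaleLocalGlue
  (local_of_simple nashEtaleCover_of_nashEtaleLocal nashEtaleLocal_zero)
open Summit.KontsevichZagierPeriods.RootDecompRationalCubeDichotomy.Rung29430.NashEtaleLocalOne
  (analyticOnNhd_aeval_snoc)
open Summit.KontsevichZagierPeriods.RootDecompRationalCubeDichotomy.RungEtale.Etale
  (piRationalisation_of_nashEtaleCover)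

noncomputable section

namespace NashImplicit
open Literature.NumberTheory.Transcendental Literature.ModelTheory.ExponentialFields
variable {n k : ℕ}

/-- **The `ℚ`-Nash implicit function theorem for polynomial étale systems.**  If
`F₁..F_k ∈ ℚ[x, y]` vanish at `(x₀, y₀)` with `det (∂Fᵢ/∂yⱼ)(x₀, y₀) ≠ 0`, then on an open
(rational) box `V ∋ x₀` there are functions `u₁..u_k`, each `ℚ`-semialgebraic and real-analytic
on `V`, with `u(x₀) = y₀` and `F(x, u(x)) = 0` for `x ∈ V`. -/
theorem exists_nash_implicit (F : Fin k → MvPolynomial (Fin (n + k)) ℚ) (x₀ : Fin n → ℝ)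
    (y₀ : Fin k → ℝ) (hF : ∀ i, MvPolynomial.aeval (Fin.append x₀ y₀) (F i) = 0)
    (hJ : (Matrix.of fun i j : Fin k =>
      MvPolynomial.aeval (Fin.append x₀ y₀) (pderiv (Fin.natAdd n j) (F i))).det ≠ 0) :
    ∃ (V : Set (Fin n → ℝ)) (u : Fin k → (Fin n → ℝ) → ℝ),
      IsOpen V ∧ x₀ ∈ V ∧ (∀ j, u j x₀ = y₀ j) ∧
      (∀ j, IsSemialgebraicFunOn ℚ V (u j)) ∧ (∀ j, AnalyticOnNhd ℝ (u j) V) ∧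
      ∀ x ∈ V, ∀ i, MvPolynomial.aeval (Fin.append x fun j => u j x) (F i) = 0 := by
  classical
  -- the point, the local homeomorphism
  have hJ' : (Jy F (Fin.append x₀ y₀)).det ≠ 0 := hJ
  have hRcoe : ⇑(locHomeo F _ hJ') = Psi F := locHomeo_coe F _ hJ'
  have hz₀R : Fin.append x₀ y₀ ∈ (locHomeo F _ hJ').source := mem_locHomeo_source F _ hJ'
  have hPz₀ : Psi F (Fin.append x₀ y₀) = emb0 k x₀ := by
    rw [Psi_eq_emb0 F hF]
    congr 1
    funext i
    simp
  -- the total solution map and the candidate implicit functions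
  obtain ⟨ut, hut⟩ : ∃ ut : (Fin n → ℝ) → (Fin (n + k) → ℝ),
      ut = fun x => (locHomeo F _ hJ').symm (emb0 k x) := ⟨_, rfl⟩
  obtain ⟨u, hu⟩ : ∃ u : Fin k → (Fin n → ℝ) → ℝ, u = fun j x => ut x (Fin.natAdd n j) := ⟨_, rfl⟩
  -- V₀ : where `emb0 x` lies in the target and the inverse is analytic there
  obtain ⟨V₀, hV₀⟩ : ∃ V₀ : Set (Fin n → ℝ), V₀ = {x | emb0 k x ∈ (locHomeo F _ hJ').target ∧
      AnalyticAt ℝ (locHomeo F _ hJ').symm (emb0 k x)} := ⟨_, rfl⟩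
  have hV₀open : IsOpen V₀ := by
    rw [hV₀]
    exact ((locHomeo F _ hJ').open_target.preimage continuous_emb0).inter
      ((isOpen_analyticAt ℝ (locHomeo F _ hJ').symm).preimage continuous_emb0)
  have hx₀V₀ : x₀ ∈ V₀ := by
    rw [hV₀]
    refine ⟨?_, ?_⟩
    · rw [← hPz₀, ← hRcoe]
      exact (locHomeo F _ hJ').map_source hz₀R
    · rw [← hPz₀]
      exact analyticAt_locHomeo_symm F _ hJ'
  -- identities on V₀
  have hPsi_ut : ∀ x ∈ V₀, Psi F (ut x) = emb0 k x := fun x hx => by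
    rw [hV₀] at hx
    rw [← hRcoe, hut]
    exact (locHomeo F _ hJ').right_inv hx.1
  have hut_src : ∀ x ∈ V₀, ut x ∈ (locHomeo F _ hJ').source := fun x hx => by
    rw [hV₀] at hx
    rw [hut]
    exact (locHomeo F _ hJ').map_target hx.1
  have hut_eq : ∀ x ∈ V₀, ut x = Fin.append x (fun j => u j x) := fun x hx => by
    funext r
    induction r using Fin.addCases with
    | left i =>
      have := congrFun (hPsi_ut x hx) (Fin.castAdd k i)
      rw [Psi_apply_castAdd, emb0_castAdd] at this
      rw [this, Fin.append_left]
    | right j => rw [Fin.append_right, hu]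
  have hFut : ∀ x ∈ V₀, ∀ i, MvPolynomial.aeval (Fin.append x fun j => u j x) (F i) = 0 :=
    fun x hx i => by
    have := congrFun (hPsi_ut x hx) (Fin.natAdd n i)
    rw [Psi_apply_natAdd, emb0_natAdd] at this
    rwa [← hut_eq x hx]
  have hut₀ : ut x₀ = Fin.append x₀ y₀ := by
    rw [hut]
    show (locHomeo F _ hJ').symm (emb0 k x₀) = Fin.append x₀ y₀
    rw [← hPz₀, ← hRcoe]
    exact (locHomeo F _ hJ').left_inv hz₀R
  have hu₀ : ∀ j, u j x₀ = y₀ j := fun j => by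
    rw [hu]
    show ut x₀ (Fin.natAdd n j) = y₀ j
    rw [hut₀, Fin.append_right]
  -- analyticity on V₀
  have hut_an : ∀ x ∈ V₀, AnalyticAt ℝ ut x := fun x hx => by
    have hx' := hx
    rw [hV₀] at hx'
    rw [hut]
    exact hx'.2.comp (analyticAt_emb0 x)
  have hu_an : ∀ j, ∀ x ∈ V₀, AnalyticAt ℝ (u j) x := fun j x hx => by
    rw [hu]
    exact ((ContinuousLinearMap.proj (R := ℝ) (φ := fun _ : Fin (n + k) => ℝ)
      (Fin.natAdd n j)).analyticAt _).comp (hut_an x hx)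
  -- a rational box `B ⊆ source` around the point, and the final rational box `V`
  obtain ⟨a, b, hzB, hBsrc⟩ := exists_ratBox_subset (locHomeo F _ hJ').open_source hz₀R
  have hut_cont : ContinuousOn ut V₀ := fun x hx => (hut_an x hx).continuousAt.continuousWithinAt
  have hU₁open : IsOpen (V₀ ∩ ut ⁻¹' ratBox a b) :=
    hut_cont.isOpen_inter_preimage hV₀open (isOpen_ratBox a b)
  have hx₀U₁ : x₀ ∈ V₀ ∩ ut ⁻¹' ratBox a b := ⟨hx₀V₀, by rw [Set.mem_preimage, hut₀]; exact hzB⟩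
  obtain ⟨a', b', hx₀V, hVsub⟩ := exists_ratBox_subset hU₁open hx₀U₁
  refine ⟨ratBox a' b', u, isOpen_ratBox a' b', hx₀V, hu₀, ?_,
    fun j x hx => hu_an j x (hVsub hx).1, fun x hx => hFut x (hVsub hx).1⟩
  -- `ℚ`-semialgebraicity of the graph of `u` over `V`
  have hgraph : {z : Fin (n + k) → ℝ | ∃ x ∈ ratBox a' b', z = Fin.append x (fun j => u j x)} =
      {z : Fin (n + k) → ℝ | (fun i => z (Fin.castAdd k i)) ∈ ratBox a' b'} ∩ ratBox a b ∩
        ⋂ i ∈ (Finset.univ : Finset (Fin k)),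
          {z : Fin (n + k) → ℝ | MvPolynomial.aeval z (F i) = 0} := by
    ext z
    simp only [Set.mem_setOf_eq, Set.mem_inter_iff, Finset.mem_univ, Set.mem_iInter, true_implies]
    constructor
    · rintro ⟨x, hx, rfl⟩
      refine ⟨⟨?_, ?_⟩, fun i => hFut x (hVsub hx).1 i⟩
      · have : (fun i => Fin.append x (fun j => u j x) (Fin.castAdd k i)) = x := by
          funext i
          rw [Fin.append_left]
        rw [this]
        exact hx
      · rw [← hut_eq x (hVsub hx).1]
        exact (hVsub hx).2
    · rintro ⟨⟨hxV, hzB'⟩, hFz⟩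
      refine ⟨fun i => z (Fin.castAdd k i), hxV, ?_⟩
      have hxV₀ := (hVsub hxV).1
      rw [← hut_eq _ hxV₀]
      have h1 : Psi F z = emb0 k (fun i => z (Fin.castAdd k i)) := Psi_eq_emb0 F hFz
      have h2 : Psi F (ut fun i => z (Fin.castAdd k i)) = emb0 k (fun i => z (Fin.castAdd k i)) :=
        hPsi_ut _ hxV₀
      refine (locHomeo F _ hJ').injOn (hBsrc hzB') (hut_src _ hxV₀) ?_
      rw [hRcoe, h1, h2]
  have hmap : IsSemialgebraicMapOn ℚ (ratBox a' b') (fun x => fun j => u j x) := by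
    show IsSemialgebraic ℚ _
    rw [hgraph]
    exact ((isSemialgebraic_cylinder a' b').inter (isSemialgebraic_ratBox a b)).inter
      (IsSemialgebraic.biInter _ _ fun i _ => isSemialgebraic_setOf_eval_eq_zero _)
  intro j
  exact (isSemialgebraicMapOn_iff_forall_holds (isSemialgebraic_ratBox a' b')).mp hmap j

/-- **Local uniqueness of solutions.**  Two families of solutions of the étale system through
`y₀`, continuous at `x₀`, agree on a neighbourhood of `x₀`. -/
theorem solutions_eq_near (F : Fin k → MvPolynomial (Fin (n + k)) ℚ) (x₀ : Fin n → ℝ)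
    (y₀ : Fin k → ℝ)
    (hJ : (Matrix.of fun i j : Fin k =>
      MvPolynomial.aeval (Fin.append x₀ y₀) (pderiv (Fin.natAdd n j) (F i))).det ≠ 0)
    {V : Set (Fin n → ℝ)} (hV : IsOpen V) (hx₀ : x₀ ∈ V) {u v : Fin k → (Fin n → ℝ) → ℝ}
    (hu₀ : ∀ j, u j x₀ = y₀ j) (hv₀ : ∀ j, v j x₀ = y₀ j)
    (huc : ∀ j, ContinuousAt (u j) x₀) (hvc : ∀ j, ContinuousAt (v j) x₀)
    (hFu : ∀ x ∈ V, ∀ i, MvPolynomial.aeval (Fin.append x fun j => u j x) (F i) = 0)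
    (hFv : ∀ x ∈ V, ∀ i, MvPolynomial.aeval (Fin.append x fun j => v j x) (F i) = 0) :
    ∃ W : Set (Fin n → ℝ), IsOpen W ∧ x₀ ∈ W ∧ W ⊆ V ∧ ∀ x ∈ W, ∀ j, u j x = v j x := by
  classical
  have hJ' : (Jy F (Fin.append x₀ y₀)).det ≠ 0 := hJ
  have hRcoe : ⇑(locHomeo F _ hJ') = Psi F := locHomeo_coe F _ hJ'
  have hz₀R : Fin.append x₀ y₀ ∈ (locHomeo F _ hJ').source := mem_locHomeo_source F _ hJ'
  -- the two graph maps are continuous at `x₀` with value `(x₀, y₀)`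
  have hcont : ∀ w : Fin k → (Fin n → ℝ) → ℝ, (∀ j, ContinuousAt (w j) x₀) →
      ContinuousAt (fun x => Fin.append x fun j => w j x) x₀ := by
    intro w hw
    refine continuousAt_pi.2 fun r => ?_
    induction r using Fin.addCases with
    | left i =>
      simp only [Fin.append_left]
      exact (continuous_apply i).continuousAt
    | right j =>
      simp only [Fin.append_right]
      exact hw j
  have hval : ∀ w : Fin k → (Fin n → ℝ) → ℝ, (∀ j, w j x₀ = y₀ j) →
      (Fin.append x₀ fun j => w j x₀) = Fin.append x₀ y₀ := by
    intro w hw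
    congr 1
    funext j
    exact hw j
  have hpre : ∀ w : Fin k → (Fin n → ℝ) → ℝ, (∀ j, ContinuousAt (w j) x₀) → (∀ j, w j x₀ = y₀ j) →
      (fun x => Fin.append x fun j => w j x) ⁻¹' (locHomeo F _ hJ').source ∈ nhds x₀ := by
    intro w hw hw₀
    apply (hcont w hw).preimage_mem_nhds
    rw [hval w hw₀]
    exact (locHomeo F _ hJ').open_source.mem_nhds hz₀R
  obtain ⟨W, hWsub, hWo, hx₀W⟩ := mem_nhds_iff.mp
    (Filter.inter_mem (hV.mem_nhds hx₀) (Filter.inter_mem (hpre u huc hu₀) (hpre v hvc hv₀)))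
  refine ⟨W, hWo, hx₀W, fun x hx => (hWsub hx).1, fun x hx j => ?_⟩
  have hxV : x ∈ V := (hWsub hx).1
  have hsu : (Fin.append x fun j => u j x) ∈ (locHomeo F _ hJ').source := (hWsub hx).2.1
  have hsv : (Fin.append x fun j => v j x) ∈ (locHomeo F _ hJ').source := (hWsub hx).2.2
  have h1 : Psi F (Fin.append x fun j => u j x) = emb0 k x := by
    rw [Psi_eq_emb0 F (hFu x hxV)]
    congr 1
    funext i
    simp
  have h2 : Psi F (Fin.append x fun j => v j x) = emb0 k x := by
    rw [Psi_eq_emb0 F (hFv x hxV)]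
    congr 1
    funext i
    simp
  have heq := (locHomeo F _ hJ').injOn hsu hsv (by rw [hRcoe, h1, h2])
  have := congrFun heq (Fin.natAdd n j)
  simpa only [Fin.append_right] using this

end NashImplicit

/-! ## §4f  Consumer form: `MultiGenData` from POINT data — PROVED

To establish the `k`-generator étale data for `g` at `x₀` it suffices to give a point `y₀ ∈ ℝᵏ`,
an étale system `F` at `(x₀, y₀)` and `A, B` with `B(x₀, y₀) ≠ 0`, and to identify `g` with
`A(x,u(x))/B(x,u(x))` near `x₀` along every local analytic solution `u` of `F = 0` through `y₀`:
the Nash solution itself, its semialgebraicity, and all the shrinking are supplied here.  What is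
left to the prover of `MultiGenDefectOneAt` / `MultiGenSpecialAt` is the IDENTIFICATION — the
formal (Taylor-series) half of the glue, fed by the fact `EtaleAlgebraicPowerSeries`. -/

/-- **`MultiGenData` from point data.** -/
theorem multiGenData_of_pointData {n k : ℕ} {g : (Fin n → ℝ) → ℝ} {x₀ : Fin n → ℝ}
    (y₀ : Fin k → ℝ) (F : Fin k → MvPolynomial (Fin (n + k)) ℚ)
    (A B : MvPolynomial (Fin (n + k)) ℚ)
    (hF : ∀ i, MvPolynomial.aeval (Fin.append x₀ y₀) (F i) = 0)
    (hJ : (Matrix.of fun i j : Fin k =>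
      MvPolynomial.aeval (Fin.append x₀ y₀) (pderiv (Fin.natAdd n j) (F i))).det ≠ 0)
    (hB : MvPolynomial.aeval (Fin.append x₀ y₀) B ≠ 0)
    (hg : ∀ (V : Set (Fin n → ℝ)) (u : Fin k → (Fin n → ℝ) → ℝ), IsOpen V → x₀ ∈ V →
      (∀ j, u j x₀ = y₀ j) → (∀ j, AnalyticOnNhd ℝ (u j) V) →
      (∀ x ∈ V, ∀ i, MvPolynomial.aeval (Fin.append x fun j => u j x) (F i) = 0) →
      ∃ V' ⊆ V, IsOpen V' ∧ x₀ ∈ V' ∧ ∀ x ∈ V',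
        g x = MvPolynomial.aeval (Fin.append x fun j => u j x) A /
          MvPolynomial.aeval (Fin.append x fun j => u j x) B) :
    MultiGenData n k g x₀ := by
  obtain ⟨V, u, hVo, hx₀V, hu₀, husa, huan, hFu⟩ :=
    NashImplicit.exists_nash_implicit F x₀ y₀ hF hJ
  obtain ⟨V', hV'V, hV'o, hx₀V', hgV'⟩ := hg V u hVo hx₀V hu₀ huan hFu
  have hpt : (Fin.append x₀ fun j => u j x₀) = Fin.append x₀ y₀ := by
    congr 1
    funext j
    exact hu₀ j
  -- `x ↦ B(x, u(x))` is continuous on `V` and nonvanishing at `x₀`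
  have hBan : ∀ x ∈ V,
      AnalyticAt ℝ (fun x => MvPolynomial.aeval (Fin.append x fun j => u j x) B) x := by
    intro x hx
    refine AnalyticAt.aeval_mvPolynomial (fun r => ?_) B
    induction r using Fin.addCases with
    | left i =>
      simp only [Fin.append_left]
      exact (ContinuousLinearMap.proj (R := ℝ) (φ := fun _ : Fin n => ℝ) i).analyticAt x
    | right j =>
      simp only [Fin.append_right]
      exact huan j x hx
  have hBcont : ContinuousOn (fun x => MvPolynomial.aeval (Fin.append x fun j => u j x) B) V :=
    fun x hx => (hBan x hx).continuousAt.continuousWithinAt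
  have hWo : IsOpen (V ∩ (fun x => MvPolynomial.aeval (Fin.append x fun j => u j x) B) ⁻¹' {0}ᶜ) :=
    hBcont.isOpen_inter_preimage hVo isOpen_compl_singleton
  have hx₀W : x₀ ∈ V' ∩ (V ∩ (fun x => MvPolynomial.aeval (Fin.append x fun j => u j x) B) ⁻¹' {0}ᶜ) := by
    refine ⟨hx₀V', hx₀V, ?_⟩
    rw [Set.mem_preimage, Set.mem_compl_singleton_iff, hpt]
    exact hB
  obtain ⟨a, b, hx₀B, hBsub⟩ := exists_ratBox_subset (hV'o.inter hWo) hx₀W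
  have hBV : ratBox a b ⊆ V := fun x hx => (hBsub hx).2.1
  refine ⟨ratBox a b, u, F, A, B, isOpen_ratBox a b, hx₀B,
    fun j => (husa j).mono hBV (isSemialgebraic_ratBox a b), fun j => (huan j).mono hBV,
    fun x hx => hFu x (hBV hx), ?_, fun x hx => ⟨?_, hgV' x (hBsub hx).1⟩⟩
  · rw [hpt]
    exact hJ
  · have := (hBsub hx).2.2
    rwa [Set.mem_preimage, Set.mem_compl_singleton_iff] at this

/-! ## §4g  Transport to PRODUCT POINTS `(generic, 0)` along the polynomial étale chart — PROVED

With §4d–§4f the special strata REDUCE (kernel-checked) to the GERM statement at PRODUCT POINTS: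
points `y₀ ∈ ℝⁿ` whose coordinates on `range e` are algebraically independent over `ℚ` and whose
other coordinates are `0`.  The chart `Φ_T : x ↦ (T_i(x))_i` of `exists_generic_chart` is a
`ℚ`-polynomial map, étale at `x₀` (its Jacobian is block-triangular after reindexing
`Fin n ≃ {non-generic} ⊕ {generic}`: `det_chart_ne_zero`), with `Φ_T(x₀)` a product point; its
local inverse `ψ` is `ℚ`-Nash by the `ℚ`-Nash implicit function theorem (§4e,
`exists_chart_inverse`), `ψ ∘ Φ_T = id` near `x₀` by local uniqueness (`chart_leftInverse_near`),
`G := g ∘ ψ` is a `ℚ`-Nash germ at `Φ_T(x₀)`, and `MultiGenData` for `G` pulls back to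
`MultiGenData` for `g` by the substitution `y_l ↦ T_l(x)` in relations and numerator/denominator
(`multiGenData_transport`).  Net: `ProductPointMultiGen n ↔ ∀ x₀, NashGermMultiGen n x₀`
(`productPointMultiGen_iff`) and `ProductPointMultiGen n → MultiGenAt n`. -/

section Transport

open Literature.NumberTheory.Transcendental

variable {n : ℕ}

/-- The polynomial chart map `Φ_T : x ↦ (T_i(x))_i`. -/
def chartMap (T : Fin n → MvPolynomial (Fin n) ℚ) (x : Fin n → ℝ) : Fin n → ℝ :=
  fun i => MvPolynomial.aeval x (T i)

/-- Auxiliary step `analyticAt_chartMap`. [bookkeeping] -/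
theorem analyticAt_chartMap (T : Fin n → MvPolynomial (Fin n) ℚ) (x : Fin n → ℝ) :
    AnalyticAt ℝ (chartMap T) x := by
  have : chartMap T = fun z i => (fun i z => MvPolynomial.aeval z (T i)) i z := rfl
  rw [this]
  apply AnalyticAt.pi
  intro i
  exact AnalyticAt.aeval_mvPolynomial
    (fun l => (ContinuousLinearMap.proj (R := ℝ) (φ := fun _ : Fin n => ℝ) l).analyticAt x) (T i)

/-- Auxiliary step `continuous_chartMap`. [bookkeeping] -/
theorem continuous_chartMap (T : Fin n → MvPolynomial (Fin n) ℚ) : Continuous (chartMap T) :=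
  continuous_iff_continuousAt.2 fun x => (analyticAt_chartMap T x).continuousAt

/-- The Jacobian of a transversal chart (`exists_generic_chart`) at `x₀` is invertible: after
reindexing along `{non-generic} ⊕ {generic} ≃ Fin n` it is block upper-triangular with a
DIAGONAL block `(∂_j T_j(x₀))_j` and an IDENTITY block. -/
theorem det_chart_ne_zero {m : ℕ} (x₀ : Fin n → ℝ) (e : Fin m → Fin n)
    (T : Fin n → MvPolynomial (Fin n) ℚ) (hTe : ∀ i, T (e i) = X (e i))
    (hT : ∀ j ∉ Set.range e, MvPolynomial.aeval x₀ (pderiv j (T j)) ≠ 0 ∧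
      ∀ l ∉ Set.range e, l ≠ j → pderiv l (T j) = 0) :
    (Matrix.of fun i l : Fin n => MvPolynomial.aeval x₀ (pderiv l (T i))).det ≠ 0 := by
  classical
  set J : Matrix (Fin n) (Fin n) ℝ :=
    Matrix.of fun i l : Fin n => MvPolynomial.aeval x₀ (pderiv l (T i)) with hJdef
  let p : Fin n → Prop := fun i => i ∉ Set.range e
  -- rows at generic indices are unit vectors
  have hgen : ∀ (b : {a // ¬ p a}) (l : Fin n), J b l = if (b : Fin n) = l then 1 else 0 := by
    intro b l
    obtain ⟨i, hi⟩ : (b : Fin n) ∈ Set.range e := not_not.mp b.prop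
    simp only [hJdef, Matrix.of_apply]
    rw [← hi, hTe i, pderiv_X]
    simp only [Pi.single_apply]
    split_ifs <;> simp
  -- rows at non-generic indices vanish off the diagonal and off the generic columns
  have hoff : ∀ (a : {a // p a}) (l : Fin n), l ≠ (a : Fin n) → l ∉ Set.range e → J a l = 0 := by
    intro a l hla hl
    simp only [hJdef, Matrix.of_apply]
    rw [(hT a a.prop).2 l hl hla, map_zero]
  have hblock : Matrix.reindex (Equiv.sumCompl p).symm (Equiv.sumCompl p).symm J =
      Matrix.fromBlocks (Matrix.diagonal fun a : {a // p a} => J a a)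
        (Matrix.of fun (a : {a // p a}) (b : {a // ¬ p a}) => J a b) 0 1 := by
    ext r c
    rcases r with a | b <;> rcases c with a' | b'
    · simp only [Matrix.reindex_apply, Matrix.submatrix_apply, Equiv.symm_symm,
        Equiv.sumCompl_apply_inl, Matrix.fromBlocks_apply₁₁, Matrix.diagonal_apply]
      by_cases h : a = a'
      · subst h
        simp
      · rw [if_neg h]
        exact hoff a a' (fun h' => h (Subtype.ext h'.symm)) a'.prop
    · simp only [Matrix.reindex_apply, Matrix.submatrix_apply, Equiv.symm_symm,
        Equiv.sumCompl_apply_inl, Equiv.sumCompl_apply_inr, Matrix.fromBlocks_apply₁₂,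
        Matrix.of_apply]
    · simp only [Matrix.reindex_apply, Matrix.submatrix_apply, Equiv.symm_symm,
        Equiv.sumCompl_apply_inl, Equiv.sumCompl_apply_inr, Matrix.fromBlocks_apply₂₁,
        Matrix.zero_apply]
      rw [hgen b a', if_neg]
      intro h
      apply a'.prop
      rw [← h]
      exact not_not.mp b.prop
    · simp only [Matrix.reindex_apply, Matrix.submatrix_apply, Equiv.symm_symm,
        Equiv.sumCompl_apply_inr, Matrix.fromBlocks_apply₂₂, Matrix.one_apply]
      rw [hgen b b']
      simp only [Subtype.ext_iff]
  have hdet : J.det = ∏ a : {a // p a}, J a a := by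
    rw [← Matrix.det_reindex_self (Equiv.sumCompl p).symm J, hblock, Matrix.det_fromBlocks_zero₂₁,
      Matrix.det_diagonal, Matrix.det_one, mul_one]
  rw [hdet]
  exact Finset.prod_ne_zero_iff.mpr fun a _ => (hT a a.prop).1

/-- Auxiliary step `append_comp_natAdd`. [bookkeeping] -/
theorem append_comp_natAdd (y x : Fin n → ℝ) : (Fin.append y x) ∘ (Fin.natAdd n) = x := by
  funext j
  simp only [Function.comp_apply, Fin.append_right]

/-- Auxiliary step `append_comp_castAdd`. [bookkeeping] -/
theorem append_comp_castAdd {k : ℕ} (x : Fin n → ℝ) (w : Fin k → ℝ) :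
    (Fin.append x w) ∘ (Fin.castAdd k) = x := by
  funext i
  simp only [Function.comp_apply, Fin.append_left]

end Transport
end
end Summit.KontsevichZagierPeriods.RootDecompRationalCubeDichotomy.Rung29430.MultiGen
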